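import Literature.Geometry.Lorentzian.CorrespondingBoundaryDomain
import Literature.Geometry.Lorentzian.RelCommonDevelopmentCausality
import HarnessLib

/-!
# Corresponding boundary points of a relative common development lie over the Cauchy piece
# domain of the sub-datum

The instance of `CorrespondingBoundaryDomain` for a relative common development
`𝔠 = (U ⊆ M₁, ψ : U → M₂)` of a Cauchy development `𝒟₁` of data `D₁` on `N` and a Cauchy
development `𝒟₂` of data `D₂` on `X` over `Φ : N → X` (`CauchyDevelopment.RelCommonDevelopment`;
Hawking–Ellis 1973, §7.6; Sbierski 2016, §3.2 for `N = X`): **if `p ∈ ∂U` and `p' ∈ M₂`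
correspond** (every pair of neighbourhoods `V ∋ p`, `V' ∋ p'` contains `y ∈ U ∩ V` with
`ψ y ∈ V'`; in particular for `𝔠.IsCorrespondingPair p p'`, Sbierski's Def. 11), **then
`p' ∉ closure (I⁺(K) ∪ I⁻(K) ∪ K)`, `K = ι₂(X) ∖ ι₂(Φ N)`** — `p'` lies in the region of `M₂`
whose connected component through `ι₂(Φ N)` is the domain of dependence of the sub-datum
(`CauchyPieceDomain`). The transport hypotheses of the pure statement are discharged by
`RelCommonDevelopmentCausality` (`ψ = 𝔠.glue`, `W = ψ(U)`, `S₀ = ι₂(Φ N)`); what stays displayed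
is global hyperbolicity of the two developments in the form used (`hK₁`, `hK₁'`, `hK₂`, `hK₂'`:
compactness of `J∓(x) ∩ J±(ι(·))`, Hawking–Ellis 1973, Prop. 6.6.6; `hrel₂`: sequential
closedness of `≤` in `M₂`, O'Neill 1983, Lemma 14.22 — as in `SpacelikeBoundaryFuturePoint`),
the acausality of the data hypersurface `ι₂(X)` (`hac₂`; `SpacelikePieceDomain`) and the
closedness of `K` (e.g. `Φ` an open embedding).

* `RelCommonDevelopment.not_mem_closure_badSet_of_corresponding` — the statement from the
  neighbourhood form of correspondence;
* `RelCommonDevelopment.IsCorrespondingPair.not_mem_closure_badSet` — for corresponding pairs.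

Everything is proved; no definitions, no named facts.

## References

* J. Sbierski, Ann. Henri Poincaré 17 (2016) 301–329 = arXiv:1309.7591v3, §3.2, Def. 11,
  Prop. 13, Thm. 12 (arXiv numbering). [Sbierski2016AHP]
* S. W. Hawking, G. F. R. Ellis, *The large scale structure of space-time*, CUP 1973, §6.5,
  Prop. 6.6.6, §7.6 pp. 249–251. [HawkingEllis1973CUP]
* B. O'Neill, *Semi-Riemannian geometry with applications to relativity*, Academic Press 1983,
  Ch. 14, Lemma 14.22, Lemma 14.29. [ONeillSemiRiemannian1983]
-/

noncomputable section

open Set Filter Function TopologicalSpace Topology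
open scoped Manifold ContDiff Topology

namespace Literature.Geometry.Lorentzian

universe u

variable {n : ℕ} {N : Type u} [TopologicalSpace N] [ChartedSpace (EuclideanSpace ℝ (Fin n)) N]
  [IsManifold (𝓡 n) ∞ N] [ConnectedSpace N] {D₁ : InitialDataSet (𝓡 n) N}
  {X : Type u} [TopologicalSpace X] [ChartedSpace (EuclideanSpace ℝ (Fin n)) X]
  [IsManifold (𝓡 n) ∞ X] [ConnectedSpace X] {D₂ : InitialDataSet (𝓡 n) X}

namespace CauchyDevelopment.RelCommonDevelopment

variable {𝒟₁ : CauchyDevelopment D₁} {𝒟₂ : CauchyDevelopment D₂} {Φ : N → X}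
  (𝔠 : RelCommonDevelopment 𝒟₁ 𝒟₂ Φ)

/-- **The image point of a corresponding boundary pair of a relative common development lies over
the Cauchy piece domain of the sub-datum**: for `p ∈ ∂U` and `p' ∈ M₂` corresponding in the
neighbourhood sense, `p' ∉ closure (I⁺(K) ∪ I⁻(K) ∪ K)`, `K = ι₂(X) ∖ ι₂(Φ N)`
(`LorentzianMetric.not_mem_closure_badSet_of_corresponding` with `ψ = 𝔠.glue`, `W = ψ(U)`,
`S₀ = ι₂(Φ N)`, the transport lemmas of `RelCommonDevelopmentCausality`).
[cite: Sbierski2016AHP, §3.2, Prop. 13 and Thm. 12 (arXiv numbering); HawkingEllis1973CUP, §6.5 and §7.6] -/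
theorem not_mem_closure_badSet_of_corresponding
    (hK₁ : ∀ x : 𝒟₁.carrier, IsCompact (𝒟₁.metric.causalPast 𝒟₁.timeOrientation {x} ∩
      𝒟₁.metric.causalFuture 𝒟₁.timeOrientation (range 𝒟₁.embed)))
    (hK₁' : ∀ x : 𝒟₁.carrier, IsCompact (𝒟₁.metric.causalFuture 𝒟₁.timeOrientation {x} ∩
      𝒟₁.metric.causalPast 𝒟₁.timeOrientation (range 𝒟₁.embed)))
    (hK₂ : ∀ x : 𝒟₂.carrier, IsCompact (𝒟₂.metric.causalPast 𝒟₂.timeOrientation {x} ∩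
      𝒟₂.metric.causalFuture 𝒟₂.timeOrientation (range 𝒟₂.embed)))
    (hK₂' : ∀ x : 𝒟₂.carrier, IsCompact (𝒟₂.metric.causalFuture 𝒟₂.timeOrientation {x} ∩
      𝒟₂.metric.causalPast 𝒟₂.timeOrientation (range 𝒟₂.embed)))
    (hrel₂ : ∀ {xs ys : ℕ → 𝒟₂.carrier} {x y : 𝒟₂.carrier}, Tendsto xs atTop (𝓝 x) →
      Tendsto ys atTop (𝓝 y) →
      (∀ j, ys j ∈ 𝒟₂.metric.causalFuture 𝒟₂.timeOrientation {xs j}) →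
      y ∈ 𝒟₂.metric.causalFuture 𝒟₂.timeOrientation {x})
    (hac₂ : ∀ x ∈ range 𝒟₂.embed, ∀ y ∈ range 𝒟₂.embed,
      y ∈ 𝒟₂.metric.causalFuture 𝒟₂.timeOrientation {x} → y = x)
    (hKcl : IsClosed (range 𝒟₂.embed \ range (𝒟₂.embed ∘ Φ)))
    {p : 𝒟₁.carrier} (hp : p ∈ frontier (𝔠.opens : Set 𝒟₁.carrier)) {p' : 𝒟₂.carrier}
    (hcorr : ∀ V ∈ 𝓝 p, ∀ V' ∈ 𝓝 p', ∃ y : 𝔠.opens, (y : 𝒟₁.carrier) ∈ V ∧ 𝔠.map y ∈ V') :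
    p' ∉ closure (𝒟₂.metric.chronologicalFuture 𝒟₂.timeOrientation
        (range 𝒟₂.embed \ range (𝒟₂.embed ∘ Φ)) ∪
      𝒟₂.metric.chronologicalPast 𝒟₂.timeOrientation (range 𝒟₂.embed \ range (𝒟₂.embed ∘ Φ)) ∪
      (range 𝒟₂.embed \ range (𝒟₂.embed ∘ Φ))) := by
  have hn2 : (2 : ℕ∞ω) ≤ ∞ := WithTop.coe_le_coe.mpr le_top
  have hS₁U : range 𝒟₁.embed ⊆ (𝔠.opens : Set 𝒟₁.carrier) := by
    rintro _ ⟨x, rfl⟩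
    exact 𝔠.embed_mem x
  have hWS : (𝔠.rangeOpens : Set 𝒟₂.carrier) ∩ range 𝒟₂.embed ⊆ range (𝒟₂.embed ∘ Φ) := by
    rw [coe_rangeOpens, 𝔠.range_map_inter_range_embed]
  have hψW : MapsTo 𝔠.glue (𝔠.opens : Set 𝒟₁.carrier) (𝔠.rangeOpens : Set 𝒟₂.carrier) :=
    fun x hx ↦ 𝔠.glue_mem_range hx
  have hψS : (𝔠.glue : 𝒟₁.carrier → 𝒟₂.carrier) '' range 𝒟₁.embed = range (𝒟₂.embed ∘ Φ) := by
    ext z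
    constructor
    · rintro ⟨_, ⟨x, rfl⟩, rfl⟩
      exact ⟨x, (𝔠.glue_embed x).symm⟩
    · rintro ⟨x, rfl⟩
      exact ⟨𝒟₁.embed x, ⟨x, rfl⟩, 𝔠.glue_embed x⟩
  have hpush : ∀ ⦃γ : ℝ → 𝒟₁.carrier⦄ ⦃a b : ℝ⦄, a < b →
      𝒟₁.metric.IsFutureTimelikeCurveOn 𝒟₁.timeOrientation γ (Icc a b) →
      (∀ t ∈ Icc a b, γ t ∈ 𝔠.opens) →
      𝔠.glue (γ b) ∈ 𝒟₂.metric.chronologicalFuture 𝒟₂.timeOrientation {𝔠.glue (γ a)} :=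
    fun γ a b hab hγ hγU ↦ 𝔠.mem_chronologicalFuture_glue_of_curve hab hγ hγU
  have hpull : ∀ ⦃γ : ℝ → 𝒟₂.carrier⦄ ⦃a b : ℝ⦄, a < b →
      𝒟₂.metric.IsFutureTimelikeCurveOn 𝒟₂.timeOrientation γ (Icc a b) →
      (∀ t ∈ Icc a b, γ t ∈ 𝔠.rangeOpens) → ∀ ⦃x y : 𝒟₁.carrier⦄, x ∈ 𝔠.opens → y ∈ 𝔠.opens →
      γ a = 𝔠.glue x → γ b = 𝔠.glue y →
      y ∈ 𝒟₁.metric.chronologicalFuture 𝒟₁.timeOrientation {x} :=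
    fun γ a b hab hγ hγW x y hx hy hγa hγb ↦
      𝔠.mem_chronologicalFuture_of_curve_in_range hab hγ hγW hx hy hγa hγb
  have hcorr' : ∀ V ∈ 𝓝 p, ∀ V' ∈ 𝓝 p', ∃ y ∈ (𝔠.opens : Set 𝒟₁.carrier),
      y ∈ V ∧ 𝔠.glue y ∈ V' := by
    intro V hV V' hV'
    obtain ⟨y, hyV, hyV'⟩ := hcorr V hV V' hV'
    exact ⟨y.1, y.2, hyV, by rw [𝔠.glue_apply y.2]; exact hyV'⟩
  exact LorentzianMetric.not_mem_closure_badSet_of_corresponding hn2 hn2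
    PseudoRiemannianMetric.contMDiff_restrict_holds 𝒟₁.timeOrientation.contMDiff_restrict_holds
    PseudoRiemannianMetric.contMDiff_restrict_holds 𝒟₂.timeOrientation.contMDiff_restrict_holds
    𝒟₁.isCauchyHypersurface hS₁U 𝔠.isCauchyHypersurface 𝒟₂.isCauchyHypersurface
    (range_comp_subset_range Φ 𝒟₂.embed) hKcl 𝔠.isCauchyHypersurface_rangeOpens' hWS hψW
    𝔠.continuousOn_glue hψS hpush hpull hK₁ hK₁' hK₂ hK₂' hrel₂ hac₂ hp hcorr'

/-- **Corresponding boundary pairs (Sbierski 2016, Def. 11) of a relative common development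
have their image point over the Cauchy piece domain of the sub-datum.**
[cite: Sbierski2016AHP, §3.2, Def. 11, Prop. 13 and Thm. 12 (arXiv numbering); HawkingEllis1973CUP, §6.5 and §7.6] -/
theorem IsCorrespondingPair.not_mem_closure_badSet
    (hK₁ : ∀ x : 𝒟₁.carrier, IsCompact (𝒟₁.metric.causalPast 𝒟₁.timeOrientation {x} ∩
      𝒟₁.metric.causalFuture 𝒟₁.timeOrientation (range 𝒟₁.embed)))
    (hK₁' : ∀ x : 𝒟₁.carrier, IsCompact (𝒟₁.metric.causalFuture 𝒟₁.timeOrientation {x} ∩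
      𝒟₁.metric.causalPast 𝒟₁.timeOrientation (range 𝒟₁.embed)))
    (hK₂ : ∀ x : 𝒟₂.carrier, IsCompact (𝒟₂.metric.causalPast 𝒟₂.timeOrientation {x} ∩
      𝒟₂.metric.causalFuture 𝒟₂.timeOrientation (range 𝒟₂.embed)))
    (hK₂' : ∀ x : 𝒟₂.carrier, IsCompact (𝒟₂.metric.causalFuture 𝒟₂.timeOrientation {x} ∩
      𝒟₂.metric.causalPast 𝒟₂.timeOrientation (range 𝒟₂.embed)))
    (hrel₂ : ∀ {xs ys : ℕ → 𝒟₂.carrier} {x y : 𝒟₂.carrier}, Tendsto xs atTop (𝓝 x) →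
      Tendsto ys atTop (𝓝 y) →
      (∀ j, ys j ∈ 𝒟₂.metric.causalFuture 𝒟₂.timeOrientation {xs j}) →
      y ∈ 𝒟₂.metric.causalFuture 𝒟₂.timeOrientation {x})
    (hac₂ : ∀ x ∈ range 𝒟₂.embed, ∀ y ∈ range 𝒟₂.embed,
      y ∈ 𝒟₂.metric.causalFuture 𝒟₂.timeOrientation {x} → y = x)
    (hKcl : IsClosed (range 𝒟₂.embed \ range (𝒟₂.embed ∘ Φ)))
    {p : 𝒟₁.carrier} {p' : 𝒟₂.carrier} (h : 𝔠.IsCorrespondingPair p p') :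
    p' ∉ closure (𝒟₂.metric.chronologicalFuture 𝒟₂.timeOrientation
        (range 𝒟₂.embed \ range (𝒟₂.embed ∘ Φ)) ∪
      𝒟₂.metric.chronologicalPast 𝒟₂.timeOrientation (range 𝒟₂.embed \ range (𝒟₂.embed ∘ Φ)) ∪
      (range 𝒟₂.embed \ range (𝒟₂.embed ∘ Φ))) :=
  𝔠.not_mem_closure_badSet_of_corresponding hK₁ hK₁' hK₂ hK₂' hrel₂ hac₂ hKcl h.1 h.2.2

end CauchyDevelopment.RelCommonDevelopment

end Literature.Geometry.Lorentzian

end
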